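import Mathlib
import HarnessLib

/-!
# The on-axis Riccati caricature of the swirl feedback, kernel-checked

Elementary complex algebra and one explicit ODE flow, recording in checkable form the structure that makes the
swirl feedback RESTORING on the symmetry axis of an axisymmetric flow (soloist analysis, HOME papers
`c10-located-barrier.md` §5 and `sharpest.md` §4.6bis).

Background (informal, not formalised here). On the axis `r = 0` of a smooth axisymmetric velocity field put
`ũ(t,z) = lim_{r→0} u_θ/r` and `ṽ(t,z) = ∂ᵣuᵣ(0,z,t) = −½ ∂_z u_z(0,z,t)`. For the Navier–Stokes equations one has along
the axis `Dũ/Dt = −2ṽũ + (viscous)`, `Dṽ/Dt = ũ² − ṽ² − π + (viscous)` with the REAL forcing `π = ∂ᵣᵣp(0,z,t)` (the radial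
pressure Hessian, nonlocal). In the exact `r`-linear solutions of T. Y. Hou and C. Li, *Dynamic stability of the three-
dimensional axisymmetric Navier–Stokes equations with swirl*, Comm. Pure Appl. Math. 61 (2008) 661–697 (arXiv:math/0608295),
eqs. (7)–(9), `π` reduces to a function of `t` alone and the swirl is stabilising. Packaging the pair as ONE complex unknown
`w = ṽ + iũ` turns the quadratic part into `−w²`; the inviscid, pressure-free caricature is the complex Riccati equation
`ẇ = −w²`, whose explicit flow `w₀/(1 + t w₀)` blows up in finite positive time iff `w₀` is a negative real number — i.e. iff
there is NO swirl (`Im w₀ = ũ₀ = 0`) and the axial strain is stretching (`ṽ₀ < 0`). Any swirl rotates the trajectory off the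
real axis and gives the decay bound `|w(t)| ≤ |w₀|/(t |Im w₀|)`.

Content (kernel-checked):
* `neg_sq_re_im`: `−(v + iu)² = (u² − v²) + i(−2vu)` (the packaging identity);
* `growth_identity`, `phase_identity`: for `ẇ = −w² − π` with real `π`, `2Re(w̄ẇ) = −2 Re(w)(|w|² + π)` and
  `Im(w̄ẇ) = −Im(w)(|w|² − π)` — modulus growth needs `Re w·(|w|² + π) < 0`, and the phase is pushed toward the blow-up
  direction (the negative real axis) only where `π > |w|²`;
* `one_add_mul_ne_zero`, `riccatiFlow_global`, `hasDerivAt_riccatiFlow`: off the negative real axis the flow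
  `riccatiFlow w₀ t = w₀/(1 + t w₀)` is defined and solves `ẇ = −w²` for all `t ≥ 0` with `w(0) = w₀`;
* `one_add_mul_eq_zero_of_neg_real`: on the negative real axis the denominator vanishes at `t = −1/Re w₀ > 0`;
* `norm_riccatiFlow_le`: the swirl-controlled decay bound.

This is a statement about an ODE caricature and about algebra valid for ANY real forcing `π`; it makes no claim about
solutions of the Navier–Stokes equations (there `π` is the nonlocal radial pressure Hessian, and the columnar cyclostrophic
balance `π = ũ²` cancels the restoring term exactly). The linter option `linter.dupNamespace` is disabled because the
mandated landing namespace repeats the summit name by design (D-0017). [problem: ns]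
-/

set_option linter.dupNamespace false

namespace Summit.NavierStokesRegularity.NavierStokesRegularity.Theorems

open Complex

noncomputable section

/-- The explicit flow of the complex Riccati equation `ẇ = −w²`: `w(t) = w₀ / (1 + t w₀)`. [problem: ns] -/
def riccatiFlow (w₀ : ℂ) (t : ℝ) : ℂ := w₀ / (1 + (t : ℂ) * w₀)

/-- Packaging identity: with `w = v + iu` (`u, v` real), `Re(−w²) = u² − v²` and `Im(−w²) = −2vu`; i.e. the on-axis pair
`v̇ = u² − v²`, `u̇ = −2vu` is the single complex equation `ẇ = −w²`. -/
theorem neg_sq_re_im (u v : ℝ) :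
    (-(((v : ℂ) + (u : ℂ) * I) ^ 2)).re = u ^ 2 - v ^ 2 ∧
      (-(((v : ℂ) + (u : ℂ) * I) ^ 2)).im = -(2 * v * u) := by
  constructor
  · simp [pow_two, Complex.mul_re, Complex.mul_im]
    try ring
  · simp [pow_two, Complex.mul_re, Complex.mul_im]
    try ring

/-- GROWTH IDENTITY for `ẇ = −w² − π` with real forcing `π`: `2 Re(w̄ · (−w² − π)) = −2 Re(w) (|w|² + π)`,
i.e. `d|w|²/dt = −2ṽ(|w|² + π)` — the modulus grows only where `Re w · (|w|² + π) < 0`. -/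
theorem growth_identity (w : ℂ) (p : ℝ) :
    2 * ((starRingEnd ℂ) w * (-(w ^ 2) - (p : ℂ))).re = -2 * w.re * (Complex.normSq w + p) := by
  simp [Complex.mul_re, Complex.mul_im, Complex.normSq_apply, pow_two]
  ring

/-- PHASE IDENTITY for `ẇ = −w² − π` with real forcing `π`: `Im(w̄ · (−w² − π)) = −Im(w) (|w|² − π)`; with
`w = |w|e^{iθ}` this is `θ̇ = −sin θ (|w|² − π)/|w|`: the phase moves toward the negative real axis (the blow-up
direction, `θ = π`) only where `π > |w|²`. -/
theorem phase_identity (w : ℂ) (p : ℝ) :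
    ((starRingEnd ℂ) w * (-(w ^ 2) - (p : ℂ))).im = -w.im * (Complex.normSq w - p) := by
  simp [Complex.mul_re, Complex.mul_im, Complex.normSq_apply, pow_two]
  ring

/-- Off the negative real axis the Riccati denominator never vanishes for `t ≥ 0`:
`Im w₀ ≠ 0 ∨ Re w₀ ≥ 0 ⟹ 1 + t w₀ ≠ 0`. -/
theorem one_add_mul_ne_zero {w₀ : ℂ} (h : w₀.im ≠ 0 ∨ 0 ≤ w₀.re) {t : ℝ} (ht : 0 ≤ t) :
    (1 : ℂ) + (t : ℂ) * w₀ ≠ 0 := by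
  intro hzero
  have hre : 1 + t * w₀.re = 0 := by
    have h1 := congrArg Complex.re hzero
    simp [Complex.mul_re] at h1
    linarith
  have him : t * w₀.im = 0 := by
    have h2 := congrArg Complex.im hzero
    simp [Complex.mul_im] at h2
    rcases h2 with h2 | h2
    · simp [h2]
    · simp [h2]
  rcases h with h | h
  · have ht0 : t = 0 := by
      rcases mul_eq_zero.mp him with h3 | h3
      · exact h3
      · exact absurd h3 h
    rw [ht0] at hre
    norm_num at hre
  · have : 0 ≤ t * w₀.re := mul_nonneg ht h
    linarith

/-- On the negative real axis the denominator DOES vanish, at the positive time `t* = −1/Re w₀` (finite-time blow-up of the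
swirl-free caricature under axial stretching `ṽ₀ < 0`). -/
theorem one_add_mul_eq_zero_of_neg_real {w₀ : ℂ} (him : w₀.im = 0) (hre : w₀.re < 0) :
    0 < -1 / w₀.re ∧ (1 : ℂ) + (((-1 / w₀.re : ℝ)) : ℂ) * w₀ = 0 := by
  refine ⟨div_pos_of_neg_of_neg (by norm_num) hre, ?_⟩
  have hne : w₀.re ≠ 0 := ne_of_lt hre
  have hmul : (-1 / w₀.re) * w₀.re = -1 := by field_simp
  apply Complex.ext
  · simp [Complex.mul_re, him, hmul]
  · simp [Complex.mul_im, him]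

/-- The Riccati flow solves `ẇ = −w²` (derivative with respect to the real time variable) wherever the denominator is
nonzero, in particular for all `t ≥ 0` off the negative real axis. -/
theorem hasDerivAt_riccatiFlow {w₀ : ℂ} (h : w₀.im ≠ 0 ∨ 0 ≤ w₀.re) {t : ℝ} (ht : 0 ≤ t) :
    HasDerivAt (riccatiFlow w₀) (-(riccatiFlow w₀ t) ^ 2) t := by
  have h1 : HasDerivAt (fun s : ℝ => (s : ℂ)) 1 t := by
    simpa using (hasDerivAt_id t).ofReal_comp
  have hden : HasDerivAt (fun s : ℝ => (1 : ℂ) + (s : ℂ) * w₀) w₀ t := by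
    simpa using (h1.mul_const w₀).const_add (1 : ℂ)
  have hne : (1 : ℂ) + (t : ℂ) * w₀ ≠ 0 := one_add_mul_ne_zero h ht
  have hd := (hasDerivAt_const t w₀).div hden hne
  have key : -(riccatiFlow w₀ t) ^ 2 =
      (0 * ((1 : ℂ) + (t : ℂ) * w₀) - w₀ * w₀) / ((1 : ℂ) + (t : ℂ) * w₀) ^ 2 := by
    unfold riccatiFlow
    rw [div_pow]
    ring
  rw [key]
  exact hd

/-- GLOBAL EXISTENCE OFF THE NEGATIVE REAL AXIS (any swirl prevents blow-up in the caricature): for `Im w₀ ≠ 0` or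
`Re w₀ ≥ 0`, `riccatiFlow w₀` has the initial value `w₀` and solves `ẇ = −w²` at every `t ≥ 0`. -/
theorem riccatiFlow_global {w₀ : ℂ} (h : w₀.im ≠ 0 ∨ 0 ≤ w₀.re) :
    riccatiFlow w₀ 0 = w₀ ∧ ∀ t : ℝ, 0 ≤ t → HasDerivAt (riccatiFlow w₀) (-(riccatiFlow w₀ t) ^ 2) t :=
  ⟨by simp [riccatiFlow], fun _ ht => hasDerivAt_riccatiFlow h ht⟩

/-- SWIRL-CONTROLLED DECAY: if `Im w₀ ≠ 0` then `|w(t)| ≤ |w₀| / (t |Im w₀|)` for `t > 0` — the larger the swirl, the faster the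
guaranteed decay of the on-axis strain/swirl pair in the caricature. -/
theorem norm_riccatiFlow_le {w₀ : ℂ} (h : w₀.im ≠ 0) {t : ℝ} (ht : 0 < t) :
    ‖riccatiFlow w₀ t‖ ≤ ‖w₀‖ / (t * |w₀.im|) := by
  unfold riccatiFlow
  rw [norm_div]
  have hpos : 0 < t * |w₀.im| := mul_pos ht (abs_pos.mpr h)
  apply div_le_div_of_nonneg_left (norm_nonneg _) hpos
  have him : ((1 : ℂ) + (t : ℂ) * w₀).im = t * w₀.im := by
    simp [Complex.mul_im]
  calc t * |w₀.im| = |((1 : ℂ) + (t : ℂ) * w₀).im| := by rw [him, abs_mul, abs_of_pos ht]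
    _ ≤ ‖(1 : ℂ) + (t : ℂ) * w₀‖ := Complex.abs_im_le_norm _

end

end Summit.NavierStokesRegularity.NavierStokesRegularity.Theorems
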